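import Mathlib
import HarnessLib
import Summits.HubbardSuperconductivity.HubbardSuperconductivity.Theorems.KLProgrammeKLRegimeEngineTowerLevStepLink
import Summits.HubbardSuperconductivity.HubbardSuperconductivity.Theorems.KLProgrammeKLRegimeEngineTowerLevStepLinkZero
import Summits.HubbardSuperconductivity.HubbardSuperconductivity.Theorems.KLProgrammeKLRegimeEngineTowerKitStepMono
import Summits.HubbardSuperconductivity.HubbardSuperconductivity.Theorems.KLProgrammeKLRegimeSectorSliceGramRegime

/-!
# Route `KLProgramme` — crux K3 ENGINE (stmt-HubbardSuperconductivity-20437 `KLRegimeEngineV17F2`), stub (b) v2, THE LEVELS PACKAGE (ℓ), (I1)→(I5)/(I7):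
# THE k-UNIFORM LINK — the levelled `hstep` of `klTowerBLev_le_law_of_inputs_uv` with ONE `(σ, τ, ψ, Φ)` for EVERY block, from FOUR k-free bounds on the block data
# («(I1)-LINK-UNIFORM», cell gate-hubbard-kl, seat hubbard-kl-k3c2-p3 g13; KL STATUS 2026-08-28 ≈20:45Z; E1's (I1)/(I5) interface by the substitute precedent — E1 may rename or supersede)

The per-block links `klTowerBLev_succ_le_kitStep` (…LevStepLink, p4 g18; blocks `k ≥ 1`) and `klTowerBLev_one_le_kitStep` (…LevStepLinkZero; block `0`) deliver
the kit's literal `hstep` with parameters depending on the block's Gram / decay / overlap data `(κ_k, α_k, cr_k, cc_k)`: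
`σ_k = κ_k²8^{dk}/(e⁴cc²)`, `τ_k = τ₀8^{dk}/(e⁴cc²)`, `ψ_k = ψ₀e⁴cc²/8^{dk}`, `Φ_k = 4α_kcc/(eκ_k²cr2^{5dk})`.  All four data are UPPER-BOUND data
(`IsGramBoundedR` is monotone in the constant; row/column sums only grow), so each block's link may be instantiated AT k-free bounds
`κ_k²·8^{dk} ≤ κ̄²`, `α_k ≤ ᾱ·4^{dk}`, `cr_k ≤ c̄r`, `cc_k ≤ c̄c` (with `ρ := κ`, `τ₀ := e⁶κ²`, `ψ₀ := κ⁻²`), and then the parameters are LITERALLY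
k-INDEPENDENT (`8^{dk}` cancels in `σ, τ, ψ`; `4^{dk}·8^{dk} = 2^{5dk}` in `Φ`):

  **`σ̄ = κ̄²/(e⁴c̄c²)`, `τ̄ = e²κ̄²/c̄c²`, `ψ̄ = e⁴c̄c²/κ̄²`, `Φ̄ = 4ᾱc̄c/(eκ̄²c̄r)`**, scaled arrays `W̄ = 64e²c̄r/(27c̄c)`, `Z̄ = 729e⁴c̄c²ε²/8` (`ε = imagTimeWeight β M`);

block `0` at the same bounds (`8^0 = 4^0 = 1`) has `σ₀ = σ̄`, `τ = τ̄`, `ψ = ψ̄`, `Φ₀ = Φ̄/2 ≤ Φ̄`, with its own array `μ0 m = W₀Z₀^m·klTowerUVLev … (2m)/ε^{2m−1}`,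
`W₀ = e²c̄r/(2c̄c)`, `Z₀ = e⁴c̄c²ε²` (the kit's right-hand side is monotone in `Φ`, `kitStepRHS_mono`).

* §0 `four_le_exp_two`, `exists_sqrt_scaled` (the Gram constant at the bound; monotonicity is `TorusFourierL2.isGramBoundedR_of_le`);
* §1 **`klTowerBLev_succ_le_kitStep_of_bounds`** — blocks `k ≥ 1` at `(σ̄, τ̄, ψ̄, Φ̄; W̄, Z̄)`;
* §2 **`klTowerBLev_one_le_kitStep_of_bounds`** — block `0` at `(σ̄, τ̄, ψ̄, Φ̄; W₀, Z₀)`;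
* §3 **`levLaw_hstep_of_blockBounds`** — the `hstep` binder of `klTowerBLev_le_law_of_inputs_uv` (…LevLawOfInputsUV) VERBATIM, its seven names
  `μ0 W Z σ τ ψ Φ` pinned by equational binders (instantiate with `rfl`) to `μ0 := fun m => W₀·Z₀^m·(klTowerUVLev … (2m)/ε^{2m−1})`, `W := W̄`, `Z := Z̄`,
  `(σ, τ, ψ, Φ) := (σ̄, τ̄, ψ̄, Φ̄)`: `∀ t, ∀ k < Kb, ∀ N ≥ 2, ∀ 3 ≤ p ≤ D, Φ·towerV D τ (μ k) < 1 → klTowerBLev … d t (k+1) p ≤ towerFO D σ (μ k) p + …`,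
  from the per-block partition-function, Gram, decay and overlap data under the four bounds and `card/2 ≤ D`.
After this, what (I5) needs from the model about the step are the four M-free numbers `κ̄²`, `ᾱ·ε`, `ε·c̄r`, `ε·c̄c` (e.g. `gram_sliceCT_bgmFat_sharp_klEng`,
`alphaWt_towerBlock_klEng_flow_all`, `overlap_jump_sums_klEng` classes) and their block-0 twins — their k-uniformity is no longer a hypothesis of the law.
Compositions of landed theorems, monotonicity and real algebra; nothing about the model is asserted beyond them; nothing asserts (ℓ), any stub, K3 or superconductivity.
References: BGM 2006 §2.8 (2.76)–(2.84), §3 (3.2)–(3.8) [cite: BenfattoGiulianiMastropietro2006].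
-/

noncomputable section

namespace Summit.HubbardSuperconductivity.HubbardSuperconductivity.Theorems.EngineV8

set_option linter.dupNamespace false -- summit = problem name (single-conjunct summit), D-0017

open Classical
open Real Finset Literature.MathematicalPhysics.QuantumLattice Literature.Probability.LatticeModels GrassmannAlgebra
open Literature.MathematicalPhysics.QuantumLattice.FermiRG
open Summit.HubbardSuperconductivity.HubbardSuperconductivity.Theorems.KLProgrammeLegKernels
open Summit.HubbardSuperconductivity.HubbardSuperconductivity.Theorems.KLRegimeSplit
open Summit.HubbardSuperconductivity.HubbardSuperconductivity.Theorems.KLRegimeWick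
open Summit.HubbardSuperconductivity.HubbardSuperconductivity.Theorems.TwoPointAssembly
open Summit.HubbardSuperconductivity.HubbardSuperconductivity.Theorems.DispersionFlow

/-! ## §0 Generic facts -/

/-- `4 ≤ e²`. [folklore] -/
theorem four_le_exp_two : (4 : ℝ) ≤ exp 2 := by
  have h1 : (2 : ℝ) ≤ exp 1 := by have := Real.exp_one_gt_d9; linarith
  have h2 : exp 2 = exp 1 ^ 2 := by rw [← Real.exp_nat_mul]; norm_num
  rw [h2]
  nlinarith

/-- For `0 < κ`, `0 < κb` and `κ²·P ≤ κb²` with `0 < P` there is `κ′ ≥ κ`, `κ′ > 0`, with `κ′²·P = κb²` (namely `κ′ = √(κb²/P)`). [folklore] -/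
theorem exists_sqrt_scaled {κ κb P : ℝ} (hκ : 0 < κ) (hκb : 0 < κb) (hP : 0 < P) (h : κ ^ 2 * P ≤ κb ^ 2) :
    ∃ κ' : ℝ, 0 < κ' ∧ κ ≤ κ' ∧ κ' ^ 2 * P = κb ^ 2 := by
  refine ⟨Real.sqrt (κb ^ 2 / P), Real.sqrt_pos.2 (by positivity), ?_, ?_⟩
  · rw [← Real.sqrt_sq hκ.le]
    exact Real.sqrt_le_sqrt (by rw [le_div_iff₀ hP]; exact h)
  · rw [Real.sq_sqrt (by positivity)]
    field_simp

variable {L M : ℕ} [NeZero L] [NeZero M]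

/-! ## §1 Blocks `k ≥ 1` at the bounds: k-free parameters -/

/-- **THE LEVELLED BLOCK STEP (`k ≥ 1`) AT k-FREE BOUNDS OF THE BLOCK DATA.**  If the block's Gram constant satisfies `κ²·8^{dk} ≤ κ̄²`, its decay constant
`α ≤ ᾱ·4^{dk}`, and its overlap row/column sums are `≤ c̄r`, `≤ c̄c`, then the kit's literal `hstep` holds with the k-INDEPENDENT parameters
`σ̄ = κ̄²/(e⁴c̄c²)`, `τ̄ = e²κ̄²/c̄c²`, `ψ̄ = e⁴c̄c²/κ̄²`, `Φ̄ = 4ᾱc̄c/(eκ̄²c̄r)` at the scaled measured array `W̄·Z̄^m·klTowerMuLev … d k m`,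
`W̄ = 64e²c̄r/(27c̄c)`, `Z̄ = 729e⁴c̄c²ε²/8`. [cite: BenfattoGiulianiMastropietro2006, §2.8 (2.76)-(2.84), §3 (3.2)-(3.8)] -/
theorem klTowerBLev_succ_le_kitStep_of_bounds {β : ℝ} (hβ : 0 < β) (U μ : ℝ) (K : TrigPolyC4v) {d k : ℕ} (hd : 1 ≤ d) (hk : 1 ≤ k)
    (hZ : hubbardEffPartitionFnCT L M β U μ 0 K (klScale klE0 (d * k)) ≠ 0)
    {κ κb : ℝ} (hκ : 0 < κ) (hκb : 0 < κb) (hκκb : κ ^ 2 * (8 : ℝ) ^ (d * k) ≤ κb ^ 2)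
    (hGB : IsGramBoundedR ((sectorSubMatrix L M β (bgmFatMultiplier L M klE0 β (nambuXiCT L μ K) (d * k - 1))).transpose *
      hubbardCovSliceCT L M β μ 0 K (klScale klE0 (d * (k + 1))) (klScale klE0 (d * k)) *
        sectorSubMatrix L M β (bgmFatMultiplier L M klE0 β (nambuXiCT L μ K) (d * k - 1))) κ)
    {α αb : ℝ} (hαb : 0 < αb) (hααb : α ≤ αb * (4 : ℝ) ^ (d * k))
    (hrow : ∀ X, ∑ Y, ‖((sectorSubMatrix L M β (bgmFatMultiplier L M klE0 β (nambuXiCT L μ K) (d * k - 1))).transpose *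
        hubbardCovSliceCT L M β μ 0 K (klScale klE0 (d * (k + 1))) (klScale klE0 (d * k)) *
          sectorSubMatrix L M β (bgmFatMultiplier L M klE0 β (nambuXiCT L μ K) (d * k - 1))) X Y‖ ≤ α)
    (hcol : ∀ Y, ∑ X, ‖((sectorSubMatrix L M β (bgmFatMultiplier L M klE0 β (nambuXiCT L μ K) (d * k - 1))).transpose *
        hubbardCovSliceCT L M β μ 0 K (klScale klE0 (d * (k + 1))) (klScale klE0 (d * k)) *
          sectorSubMatrix L M β (bgmFatMultiplier L M klE0 β (nambuXiCT L μ K) (d * k - 1))) X Y‖ ≤ α)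
    {crb ccb : ℝ} (hcrb : 0 < crb) (hccb : 0 < ccb)
    (hrow' : ∀ X'', ∑ X', ‖(sectorAnalysisMatrix L M β (klAnisoFamily L M β μ K klE0 (d * k)) *
        sectorSubMatrix L M β (bgmFatMultiplier L M klE0 β (nambuXiCT L μ K) (d * k - 1))) X'' X'‖ ≤ crb)
    (hcol' : ∀ X', ∑ X'', ‖(sectorAnalysisMatrix L M β (klAnisoFamily L M β μ K klE0 (d * k)) *
        sectorSubMatrix L M β (bgmFatMultiplier L M klE0 β (nambuXiCT L μ K) (d * k - 1))) X'' X'‖ ≤ ccb)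
    {D : ℕ} (hD : Fintype.card (SpaceTimeIdx L M × SectorLeg (sectorCount (d * k - 1))) / 2 ≤ D)
    {N : ℕ} (hN : 1 ≤ N)
    (hguard : 4 * αb * ccb / (exp 1 * κb ^ 2 * crb) *
      towerV D (exp 2 * κb ^ 2 / ccb ^ 2)
        (fun m => 64 * exp 2 * crb / (27 * ccb) * (729 * exp 4 * ccb ^ 2 * imagTimeWeight β M ^ 2 / 8) ^ m * klTowerMuLev L M β U μ K d k m) < 1)
    (t : Fin 5) (q : ℕ) :
    klTowerBLev L M β U μ K d t (k + 1) (q + 1) ≤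
      towerFO D (κb ^ 2 / (exp 4 * ccb ^ 2))
          (fun m => 64 * exp 2 * crb / (27 * ccb) * (729 * exp 4 * ccb ^ 2 * imagTimeWeight β M ^ 2 / 8) ^ m * klTowerMuLev L M β U μ K d k m) (q + 1) +
        ∑ n ∈ Icc 2 N, exp 1 * (4 * αb * ccb / (exp 1 * κb ^ 2 * crb)) ^ (n - 1) * (exp 4 * ccb ^ 2 / κb ^ 2) ^ (q + 1) *
          towerS D (exp 2 * κb ^ 2 / ccb ^ 2)
            (fun m => 64 * exp 2 * crb / (27 * ccb) * (729 * exp 4 * ccb ^ 2 * imagTimeWeight β M ^ 2 / 8) ^ m * klTowerMuLev L M β U μ K d k m) n (q + 1) +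
        (exp 4 * ccb ^ 2 / κb ^ 2) ^ (q + 1) * exp 1 *
          towerV D (exp 2 * κb ^ 2 / ccb ^ 2)
            (fun m => 64 * exp 2 * crb / (27 * ccb) * (729 * exp 4 * ccb ^ 2 * imagTimeWeight β M ^ 2 / 8) ^ m * klTowerMuLev L M β U μ K d k m) *
          (4 * αb * ccb / (exp 1 * κb ^ 2 * crb) *
            towerV D (exp 2 * κb ^ 2 / ccb ^ 2)
              (fun m => 64 * exp 2 * crb / (27 * ccb) * (729 * exp 4 * ccb ^ 2 * imagTimeWeight β M ^ 2 / 8) ^ m * klTowerMuLev L M β U μ K d k m)) ^ N /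
          (1 - 4 * αb * ccb / (exp 1 * κb ^ 2 * crb) *
            towerV D (exp 2 * κb ^ 2 / ccb ^ 2)
              (fun m => 64 * exp 2 * crb / (27 * ccb) * (729 * exp 4 * ccb ^ 2 * imagTimeWeight β M ^ 2 / 8) ^ m * klTowerMuLev L M β U μ K d k m)) := by
  have h8 : (0 : ℝ) < (8 : ℝ) ^ (d * k) := by positivity
  -- the Gram constant at the bound: `κ′ ≥ κ`, `κ′²·8^{dk} = κ̄²`
  obtain ⟨κ', hκ'0, hκκ', hκ'sq⟩ := exists_sqrt_scaled hκ hκb h8 hκκb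
  have hGB' := TorusFourierL2.isGramBoundedR_of_le hGB hκ.le hκκ'
  -- the decay constant at the bound
  have hα'0 : 0 < αb * (4 : ℝ) ^ (d * k) := by positivity
  have hrow2 : ∀ X, ∑ Y, ‖((sectorSubMatrix L M β (bgmFatMultiplier L M klE0 β (nambuXiCT L μ K) (d * k - 1))).transpose *
      hubbardCovSliceCT L M β μ 0 K (klScale klE0 (d * (k + 1))) (klScale klE0 (d * k)) *
        sectorSubMatrix L M β (bgmFatMultiplier L M klE0 β (nambuXiCT L μ K) (d * k - 1))) X Y‖ ≤ αb * (4 : ℝ) ^ (d * k) :=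
    fun X => (hrow X).trans hααb
  have hcol2 : ∀ Y, ∑ X, ‖((sectorSubMatrix L M β (bgmFatMultiplier L M klE0 β (nambuXiCT L μ K) (d * k - 1))).transpose *
      hubbardCovSliceCT L M β μ 0 K (klScale klE0 (d * (k + 1))) (klScale klE0 (d * k)) *
        sectorSubMatrix L M β (bgmFatMultiplier L M klE0 β (nambuXiCT L μ K) (d * k - 1))) X Y‖ ≤ αb * (4 : ℝ) ^ (d * k) :=
    fun Y => (hcol Y).trans hααb
  -- `τ₀ := e⁶κ′²`, `ψ₀ := κ′⁻²`, `ρ := κ′`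
  have he6 : exp 3 ^ 2 = exp 6 := by rw [← Real.exp_nat_mul]; norm_num
  have hτ1 : (exp 3 * κ') ^ 2 ≤ exp 6 * κ' ^ 2 := by rw [mul_pow, he6]
  have hτ2 : (exp 2 * (κ' + κ')) ^ 2 ≤ exp 6 * κ' ^ 2 := by
    have he4 : exp 2 ^ 2 = exp 4 := by rw [← Real.exp_nat_mul]; norm_num
    have he6' : exp 6 = exp 2 * exp 4 := by rw [← exp_add]; norm_num
    have hk2 : 0 ≤ κ' ^ 2 := sq_nonneg _
    calc (exp 2 * (κ' + κ')) ^ 2 = 4 * exp 4 * κ' ^ 2 := by rw [← he4]; ring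
      _ ≤ exp 2 * exp 4 * κ' ^ 2 := mul_le_mul_of_nonneg_right (mul_le_mul_of_nonneg_right four_le_exp_two (exp_pos 4).le) hk2
      _ = exp 6 * κ' ^ 2 := by rw [he6']
  have hψ1 : κ'⁻¹ ^ 2 ≤ κ'⁻¹ ^ 2 := le_rfl
  -- the parameter identities
  have he2 : exp 6 = exp 2 * exp 4 := by rw [← exp_add]; norm_num
  have h32 : (2 : ℝ) ^ (5 * (d * k)) = (4 : ℝ) ^ (d * k) * (8 : ℝ) ^ (d * k) := by
    rw [← mul_pow, show (4 : ℝ) * 8 = 2 ^ 5 by norm_num, ← pow_mul]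
  have hσeq : κ' ^ 2 * (8 : ℝ) ^ (d * k) / (exp 4 * ccb ^ 2) = κb ^ 2 / (exp 4 * ccb ^ 2) := by rw [hκ'sq]
  have hτeq : exp 6 * κ' ^ 2 * (8 : ℝ) ^ (d * k) / (exp 4 * ccb ^ 2) = exp 2 * κb ^ 2 / ccb ^ 2 := by
    rw [mul_assoc, hκ'sq, he2]
    have : 0 < exp 4 := exp_pos 4
    field_simp
  have hψeq : κ'⁻¹ ^ 2 * (exp 4 * ccb ^ 2) / (8 : ℝ) ^ (d * k) = exp 4 * ccb ^ 2 / κb ^ 2 := by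
    rw [← hκ'sq, inv_pow]
    field_simp
  have hΦeq : 4 * (αb * (4 : ℝ) ^ (d * k)) * ccb / (exp 1 * κ' ^ 2 * crb * (2 : ℝ) ^ (5 * (d * k))) =
      4 * αb * ccb / (exp 1 * κb ^ 2 * crb) := by
    rw [h32, ← hκ'sq]
    have h4 : (0 : ℝ) < (4 : ℝ) ^ (d * k) := by positivity
    field_simp
  -- the block link at these data
  have h := klTowerBLev_succ_le_kitStep (L := L) (M := M) hβ U μ K hd hk hZ hκ'0 hGB' hα'0 hrow2 hcol2 hκ'0 hcrb hccb hrow' hcol' hD hN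
    (τ₀ := exp 6 * κ' ^ 2) (ψ₀ := κ'⁻¹ ^ 2) hτ1 hτ2 hψ1 hψ1 (by rw [hΦeq, hτeq]; exact hguard) t q
  rw [hσeq, hτeq, hψeq, hΦeq] at h
  exact h

/-! ## §2 Block `0` at the bounds -/

/-- **THE LEVELLED BLOCK STEP AT BLOCK `0` AT THE SAME BOUNDS** (`κ₀² ≤ κ̄²`, `α₀ ≤ ᾱ`, overlap sums `≤ c̄r`, `≤ c̄c`): the kit's literal `hstep` for
`klTowerBLev … d t 1 p` with the SAME `(σ̄, τ̄, ψ̄, Φ̄)` as the blocks `k ≥ 1` (block `0`'s own `Φ₀ = Φ̄/2` enlarged by `kitStepRHS_mono`) at the array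
`μ0 m = W₀·Z₀^m·(klTowerUVLev … (2m)/ε^{2m−1})`, `W₀ = e²c̄r/(2c̄c)`, `Z₀ = e⁴c̄c²ε²`. [cite: BenfattoGiulianiMastropietro2006, §2.8 (2.76)-(2.84), §3 (3.2)-(3.8)] -/
theorem klTowerBLev_one_le_kitStep_of_bounds {β : ℝ} (hβ : 0 < β) (U μ : ℝ) (K : TrigPolyC4v) (d : ℕ)
    (hZ : hubbardEffPartitionFnCT L M β U μ 0 K (klScale klE0 0) ≠ 0)
    {κ κb : ℝ} (hκ : 0 < κ) (hκb : 0 < κb) (hκκb : κ ^ 2 ≤ κb ^ 2)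
    (hGB : IsGramBoundedR ((sectorSubMatrix L M β (trivialMultiplier L M)).transpose *
      hubbardCovSliceCT L M β μ 0 K (klScale klE0 d) (klScale klE0 0) * sectorSubMatrix L M β (trivialMultiplier L M)) κ)
    {α αb : ℝ} (hαb : 0 < αb) (hααb : α ≤ αb)
    (hrow : ∀ X, ∑ Y, ‖((sectorSubMatrix L M β (trivialMultiplier L M)).transpose *
        hubbardCovSliceCT L M β μ 0 K (klScale klE0 d) (klScale klE0 0) * sectorSubMatrix L M β (trivialMultiplier L M)) X Y‖ ≤ α)
    (hcol : ∀ Y, ∑ X, ‖((sectorSubMatrix L M β (trivialMultiplier L M)).transpose *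
        hubbardCovSliceCT L M β μ 0 K (klScale klE0 d) (klScale klE0 0) * sectorSubMatrix L M β (trivialMultiplier L M)) X Y‖ ≤ α)
    {crb ccb : ℝ} (hcrb : 0 < crb) (hccb : 0 < ccb)
    (hrow' : ∀ X'', ∑ X', ‖(sectorAnalysisMatrix L M β (klAnisoFamily L M β μ K klE0 0) * sectorSubMatrix L M β (trivialMultiplier L M)) X'' X'‖ ≤ crb)
    (hcol' : ∀ X', ∑ X'', ‖(sectorAnalysisMatrix L M β (klAnisoFamily L M β μ K klE0 0) * sectorSubMatrix L M β (trivialMultiplier L M)) X'' X'‖ ≤ ccb)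
    {D : ℕ} (hD : Fintype.card (SpaceTimeIdx L M × SectorLeg 1) / 2 ≤ D)
    {N : ℕ} (hN : 1 ≤ N)
    (hguard : 4 * αb * ccb / (exp 1 * κb ^ 2 * crb) *
      towerV D (exp 2 * κb ^ 2 / ccb ^ 2)
        (fun m => exp 2 * crb / (2 * ccb) * (exp 4 * ccb ^ 2 * imagTimeWeight β M ^ 2) ^ m *
          (klTowerUVLev L M β U μ K (2 * m) / imagTimeWeight β M ^ (2 * m - 1))) < 1)
    (t : Fin 5) (q : ℕ) :
    klTowerBLev L M β U μ K d t 1 (q + 1) ≤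
      towerFO D (κb ^ 2 / (exp 4 * ccb ^ 2))
          (fun m => exp 2 * crb / (2 * ccb) * (exp 4 * ccb ^ 2 * imagTimeWeight β M ^ 2) ^ m *
            (klTowerUVLev L M β U μ K (2 * m) / imagTimeWeight β M ^ (2 * m - 1))) (q + 1) +
        ∑ n ∈ Icc 2 N, exp 1 * (4 * αb * ccb / (exp 1 * κb ^ 2 * crb)) ^ (n - 1) * (exp 4 * ccb ^ 2 / κb ^ 2) ^ (q + 1) *
          towerS D (exp 2 * κb ^ 2 / ccb ^ 2)
            (fun m => exp 2 * crb / (2 * ccb) * (exp 4 * ccb ^ 2 * imagTimeWeight β M ^ 2) ^ m *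
              (klTowerUVLev L M β U μ K (2 * m) / imagTimeWeight β M ^ (2 * m - 1))) n (q + 1) +
        (exp 4 * ccb ^ 2 / κb ^ 2) ^ (q + 1) * exp 1 *
          towerV D (exp 2 * κb ^ 2 / ccb ^ 2)
            (fun m => exp 2 * crb / (2 * ccb) * (exp 4 * ccb ^ 2 * imagTimeWeight β M ^ 2) ^ m *
              (klTowerUVLev L M β U μ K (2 * m) / imagTimeWeight β M ^ (2 * m - 1))) *
          (4 * αb * ccb / (exp 1 * κb ^ 2 * crb) *
            towerV D (exp 2 * κb ^ 2 / ccb ^ 2)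
              (fun m => exp 2 * crb / (2 * ccb) * (exp 4 * ccb ^ 2 * imagTimeWeight β M ^ 2) ^ m *
                (klTowerUVLev L M β U μ K (2 * m) / imagTimeWeight β M ^ (2 * m - 1)))) ^ N /
          (1 - 4 * αb * ccb / (exp 1 * κb ^ 2 * crb) *
            towerV D (exp 2 * κb ^ 2 / ccb ^ 2)
              (fun m => exp 2 * crb / (2 * ccb) * (exp 4 * ccb ^ 2 * imagTimeWeight β M ^ 2) ^ m *
                (klTowerUVLev L M β U μ K (2 * m) / imagTimeWeight β M ^ (2 * m - 1)))) := by
  have hx : 0 < imagTimeWeight β M := imagTimeWeight_pos_of_pos (M := M) hβ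
  -- the Gram and decay constants at the bounds
  have hκκ' : κ ≤ κb := (pow_le_pow_iff_left₀ hκ.le hκb.le (by norm_num : (2 : ℕ) ≠ 0)).1 hκκb
  have hGB' := TorusFourierL2.isGramBoundedR_of_le hGB hκ.le hκκ'
  have hrow2 : ∀ X, ∑ Y, ‖((sectorSubMatrix L M β (trivialMultiplier L M)).transpose *
      hubbardCovSliceCT L M β μ 0 K (klScale klE0 d) (klScale klE0 0) * sectorSubMatrix L M β (trivialMultiplier L M)) X Y‖ ≤ αb :=
    fun X => (hrow X).trans hααb
  have hcol2 : ∀ Y, ∑ X, ‖((sectorSubMatrix L M β (trivialMultiplier L M)).transpose *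
      hubbardCovSliceCT L M β μ 0 K (klScale klE0 d) (klScale klE0 0) * sectorSubMatrix L M β (trivialMultiplier L M)) X Y‖ ≤ αb :=
    fun Y => (hcol Y).trans hααb
  -- `τ₀ := e⁶κ̄²`, `ψ₀ := κ̄⁻²`, `ρ := κ̄`
  have he6 : exp 3 ^ 2 = exp 6 := by rw [← Real.exp_nat_mul]; norm_num
  have hτ1 : (exp 3 * κb) ^ 2 ≤ exp 6 * κb ^ 2 := by rw [mul_pow, he6]
  have hτ2 : (exp 2 * (κb + κb)) ^ 2 ≤ exp 6 * κb ^ 2 := by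
    have he4 : exp 2 ^ 2 = exp 4 := by rw [← Real.exp_nat_mul]; norm_num
    have he6' : exp 6 = exp 2 * exp 4 := by rw [← exp_add]; norm_num
    have hk2 : 0 ≤ κb ^ 2 := sq_nonneg _
    calc (exp 2 * (κb + κb)) ^ 2 = 4 * exp 4 * κb ^ 2 := by rw [← he4]; ring
      _ ≤ exp 2 * exp 4 * κb ^ 2 := mul_le_mul_of_nonneg_right (mul_le_mul_of_nonneg_right four_le_exp_two (exp_pos 4).le) hk2
      _ = exp 6 * κb ^ 2 := by rw [he6']
  have hψ1 : κb⁻¹ ^ 2 ≤ κb⁻¹ ^ 2 := le_rfl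
  -- the parameter identities
  have he2 : exp 6 = exp 2 * exp 4 := by rw [← exp_add]; norm_num
  have hτeq : exp 6 * κb ^ 2 / (exp 4 * ccb ^ 2) = exp 2 * κb ^ 2 / ccb ^ 2 := by
    rw [he2]
    have : 0 < exp 4 := exp_pos 4
    field_simp
  have hψeq : κb⁻¹ ^ 2 * (exp 4 * ccb ^ 2) = exp 4 * ccb ^ 2 / κb ^ 2 := by
    rw [inv_pow, div_eq_mul_inv, mul_comm]
  -- abbreviations for the kit monotonicity
  set μk : ℕ → ℝ := fun m => exp 2 * crb / (2 * ccb) * (exp 4 * ccb ^ 2 * imagTimeWeight β M ^ 2) ^ m *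
    (klTowerUVLev L M β U μ K (2 * m) / imagTimeWeight β M ^ (2 * m - 1)) with hμk
  have hμk0 : ∀ m, 0 ≤ μk m := fun m => by
    have := klTowerUVLev_nonneg (L := L) (M := M) hβ.le U μ K (2 * m)
    simp only [hμk]
    positivity
  set Φ₀ : ℝ := 2 * αb * ccb / (exp 1 * κb ^ 2 * crb) with hΦ₀
  set Φb : ℝ := 4 * αb * ccb / (exp 1 * κb ^ 2 * crb) with hΦb
  have hΦ₀0 : 0 ≤ Φ₀ := by positivity
  have hΦ₀b : Φ₀ ≤ Φb := by
    rw [hΦ₀, hΦb]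
    exact div_le_div_of_nonneg_right (by nlinarith [hαb.le, hccb.le]) (by positivity)
  have hσ0 : 0 ≤ κb ^ 2 / (exp 4 * ccb ^ 2) := by positivity
  have hτ0 : 0 ≤ exp 2 * κb ^ 2 / ccb ^ 2 := by positivity
  have hψ0 : 0 ≤ exp 4 * ccb ^ 2 / κb ^ 2 := by positivity
  -- block 0's own guard (at `Φ₀ ≤ Φ̄`)
  have hV0 : 0 ≤ towerV D (exp 2 * κb ^ 2 / ccb ^ 2) μk := towerV_nonneg hτ0 hμk0
  have hguard0 : Φ₀ * towerV D (exp 2 * κb ^ 2 / ccb ^ 2) μk < 1 :=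
    lt_of_le_of_lt (mul_le_mul_of_nonneg_right hΦ₀b hV0) hguard
  -- the block-0 link at these data
  have h := klTowerBLev_one_le_kitStep (L := L) (M := M) hβ U μ K d hZ hκb hGB' hαb hrow2 hcol2 hκb hcrb hccb hrow' hcol' hD hN
    (τ₀ := exp 6 * κb ^ 2) (ψ₀ := κb⁻¹ ^ 2) hτ1 hτ2 hψ1 hψ1 (by rw [hτeq]; exact hguard0) t q
  rw [hτeq, hψeq] at h
  -- enlarge `Φ₀ ↦ Φ̄`
  have hmono := kitStepRHS_mono (D := D) (N := N) (p := q + 1) hμk0 hσ0 le_rfl hτ0 le_rfl hψ0 le_rfl hΦ₀0 hΦ₀b hguard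
  have hreshape : ∀ (Φ ψ : ℝ), towerFO D (κb ^ 2 / (exp 4 * ccb ^ 2)) μk (q + 1) +
      ∑ n ∈ Icc 2 N, exp 1 * Φ ^ (n - 1) * ψ ^ (q + 1) * towerS D (exp 2 * κb ^ 2 / ccb ^ 2) μk n (q + 1) +
      ψ ^ (q + 1) * exp 1 * towerV D (exp 2 * κb ^ 2 / ccb ^ 2) μk * (Φ * towerV D (exp 2 * κb ^ 2 / ccb ^ 2) μk) ^ N /
        (1 - Φ * towerV D (exp 2 * κb ^ 2 / ccb ^ 2) μk) =
      towerFO D (κb ^ 2 / (exp 4 * ccb ^ 2)) μk (q + 1) +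
      ∑ n ∈ Icc 2 N, exp 1 * Φ ^ (n - 1) * ψ ^ (q + 1) * towerS D (exp 2 * κb ^ 2 / ccb ^ 2) μk n (q + 1) +
      ψ ^ (q + 1) * (exp 1 * towerV D (exp 2 * κb ^ 2 / ccb ^ 2) μk * (Φ * towerV D (exp 2 * κb ^ 2 / ccb ^ 2) μk) ^ N /
        (1 - Φ * towerV D (exp 2 * κb ^ 2 / ccb ^ 2) μk)) := fun Φ ψ => by ring
  rw [hreshape] at h ⊢
  exact h.trans hmono

/-! ## §3 The `hstep` binder of the levelled law, uniformly in the block -/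

/-- **THE k-UNIFORM LINK** («(I1)-LINK-UNIFORM»): the `hstep` binder of `klTowerBLev_le_law_of_inputs_uv` VERBATIM — the law's seven names
`μ0 W Z σ τ ψ Φ` are binders pinned by equations (instantiate each with `rfl`) to `μ0 m = W₀·Z₀^m·(klTowerUVLev … (2m)/ε^{2m−1})`
(`W₀ = e²c̄r/(2c̄c)`, `Z₀ = e⁴c̄c²ε²`), `W = 64e²c̄r/(27c̄c)`, `Z = 729e⁴c̄c²ε²/8`, `σ = κ̄²/(e⁴c̄c²)`, `τ = e²κ̄²/c̄c²`, `ψ = e⁴c̄c²/κ̄²`,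
`Φ = 4ᾱc̄c/(eκ̄²c̄r)` — from the per-block partition-function, Gram, decay and overlap data under the four k-free bounds `κ_k²·8^{dk} ≤ κ̄²`,
`α_k ≤ ᾱ·4^{dk}`, overlap sums `≤ c̄r, c̄c` (block `0`: `κ₀² ≤ κ̄²`, `α₀ ≤ ᾱ`, the same overlap bounds) and `card/2 ≤ D`.
[cite: BenfattoGiulianiMastropietro2006, §2.8 (2.76)-(2.84), §3 (3.2)-(3.8)] -/
theorem levLaw_hstep_of_blockBounds {β : ℝ} (hβ : 0 < β) (U μ : ℝ) (K : TrigPolyC4v) {d : ℕ} (hd : 1 ≤ d) (Kb : ℕ)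
    (hZ0 : hubbardEffPartitionFnCT L M β U μ 0 K (klScale klE0 0) ≠ 0)
    (hZ : ∀ k, 1 ≤ k → k < Kb → hubbardEffPartitionFnCT L M β U μ 0 K (klScale klE0 (d * k)) ≠ 0)
    {κb αb crb ccb : ℝ} (hκb : 0 < κb) (hαb : 0 < αb) (hcrb : 0 < crb) (hccb : 0 < ccb)
    (κ α : ℕ → ℝ) (hκ : ∀ k, k < Kb → 0 < κ k) (hκκb : ∀ k, k < Kb → κ k ^ 2 * (8 : ℝ) ^ (d * k) ≤ κb ^ 2)
    (hααb : ∀ k, k < Kb → α k ≤ αb * (4 : ℝ) ^ (d * k))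
    -- block 0 (trivial input family, slice `(Λ_d, Λ_0]`, analysed by `F_0`)
    (hGB0 : 0 < Kb → IsGramBoundedR ((sectorSubMatrix L M β (trivialMultiplier L M)).transpose *
      hubbardCovSliceCT L M β μ 0 K (klScale klE0 d) (klScale klE0 0) * sectorSubMatrix L M β (trivialMultiplier L M)) (κ 0))
    (hrow0 : 0 < Kb → ∀ X, ∑ Y, ‖((sectorSubMatrix L M β (trivialMultiplier L M)).transpose *
        hubbardCovSliceCT L M β μ 0 K (klScale klE0 d) (klScale klE0 0) * sectorSubMatrix L M β (trivialMultiplier L M)) X Y‖ ≤ α 0)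
    (hcol0 : 0 < Kb → ∀ Y, ∑ X, ‖((sectorSubMatrix L M β (trivialMultiplier L M)).transpose *
        hubbardCovSliceCT L M β μ 0 K (klScale klE0 d) (klScale klE0 0) * sectorSubMatrix L M β (trivialMultiplier L M)) X Y‖ ≤ α 0)
    (hrow0' : 0 < Kb → ∀ X'', ∑ X', ‖(sectorAnalysisMatrix L M β (klAnisoFamily L M β μ K klE0 0) * sectorSubMatrix L M β (trivialMultiplier L M)) X'' X'‖ ≤ crb)
    (hcol0' : 0 < Kb → ∀ X', ∑ X'', ‖(sectorAnalysisMatrix L M β (klAnisoFamily L M β μ K klE0 0) * sectorSubMatrix L M β (trivialMultiplier L M)) X'' X'‖ ≤ ccb)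
    -- blocks `k ≥ 1` (input `𝒱_{dk}` at `F_{dk−1}`, slice `(Λ_{d(k+1)}, Λ_{dk}]`, analysed by `F_{dk}`)
    (hGB : ∀ k, 1 ≤ k → k < Kb → IsGramBoundedR ((sectorSubMatrix L M β (bgmFatMultiplier L M klE0 β (nambuXiCT L μ K) (d * k - 1))).transpose *
      hubbardCovSliceCT L M β μ 0 K (klScale klE0 (d * (k + 1))) (klScale klE0 (d * k)) *
        sectorSubMatrix L M β (bgmFatMultiplier L M klE0 β (nambuXiCT L μ K) (d * k - 1))) (κ k))
    (hrow : ∀ k, 1 ≤ k → k < Kb → ∀ X, ∑ Y, ‖((sectorSubMatrix L M β (bgmFatMultiplier L M klE0 β (nambuXiCT L μ K) (d * k - 1))).transpose *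
        hubbardCovSliceCT L M β μ 0 K (klScale klE0 (d * (k + 1))) (klScale klE0 (d * k)) *
          sectorSubMatrix L M β (bgmFatMultiplier L M klE0 β (nambuXiCT L μ K) (d * k - 1))) X Y‖ ≤ α k)
    (hcol : ∀ k, 1 ≤ k → k < Kb → ∀ Y, ∑ X, ‖((sectorSubMatrix L M β (bgmFatMultiplier L M klE0 β (nambuXiCT L μ K) (d * k - 1))).transpose *
        hubbardCovSliceCT L M β μ 0 K (klScale klE0 (d * (k + 1))) (klScale klE0 (d * k)) *
          sectorSubMatrix L M β (bgmFatMultiplier L M klE0 β (nambuXiCT L μ K) (d * k - 1))) X Y‖ ≤ α k)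
    (hrow' : ∀ k, 1 ≤ k → k < Kb → ∀ X'', ∑ X', ‖(sectorAnalysisMatrix L M β (klAnisoFamily L M β μ K klE0 (d * k)) *
        sectorSubMatrix L M β (bgmFatMultiplier L M klE0 β (nambuXiCT L μ K) (d * k - 1))) X'' X'‖ ≤ crb)
    (hcol' : ∀ k, 1 ≤ k → k < Kb → ∀ X', ∑ X'', ‖(sectorAnalysisMatrix L M β (klAnisoFamily L M β μ K klE0 (d * k)) *
        sectorSubMatrix L M β (bgmFatMultiplier L M klE0 β (nambuXiCT L μ K) (d * k - 1))) X'' X'‖ ≤ ccb)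
    {D : ℕ} (hD0 : 0 < Kb → Fintype.card (SpaceTimeIdx L M × SectorLeg 1) / 2 ≤ D)
    (hD : ∀ k, 1 ≤ k → k < Kb → Fintype.card (SpaceTimeIdx L M × SectorLeg (sectorCount (d * k - 1))) / 2 ≤ D)
    {μ0 : ℕ → ℝ} {W Z σ τ ψ Φ : ℝ}
    (hμ0 : μ0 = fun m => exp 2 * crb / (2 * ccb) * (exp 4 * ccb ^ 2 * imagTimeWeight β M ^ 2) ^ m *
      (klTowerUVLev L M β U μ K (2 * m) / imagTimeWeight β M ^ (2 * m - 1)))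
    (hW : W = 64 * exp 2 * crb / (27 * ccb)) (hZ' : Z = 729 * exp 4 * ccb ^ 2 * imagTimeWeight β M ^ 2 / 8)
    (hσ : σ = κb ^ 2 / (exp 4 * ccb ^ 2)) (hτ : τ = exp 2 * κb ^ 2 / ccb ^ 2) (hψ : ψ = exp 4 * ccb ^ 2 / κb ^ 2)
    (hΦ : Φ = 4 * αb * ccb / (exp 1 * κb ^ 2 * crb)) :
    ∀ t : Fin 5, ∀ k < Kb, ∀ N : ℕ, 2 ≤ N → ∀ p, 3 ≤ p → p ≤ D →
      Φ * towerV D τ (fun m => if k = 0 then μ0 m else W * Z ^ m * klTowerMuLev L M β U μ K d k m) < 1 →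
      klTowerBLev L M β U μ K d t (k + 1) p ≤
        towerFO D σ (fun m => if k = 0 then μ0 m else W * Z ^ m * klTowerMuLev L M β U μ K d k m) p +
          ∑ n ∈ Icc 2 N, exp 1 * Φ ^ (n - 1) * ψ ^ p *
            towerS D τ (fun m => if k = 0 then μ0 m else W * Z ^ m * klTowerMuLev L M β U μ K d k m) n p +
          ψ ^ p * exp 1 * towerV D τ (fun m => if k = 0 then μ0 m else W * Z ^ m * klTowerMuLev L M β U μ K d k m) *
            (Φ * towerV D τ (fun m => if k = 0 then μ0 m else W * Z ^ m * klTowerMuLev L M β U μ K d k m)) ^ N /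
            (1 - Φ * towerV D τ (fun m => if k = 0 then μ0 m else W * Z ^ m * klTowerMuLev L M β U μ K d k m)) := by
  subst hμ0 hW hZ' hσ hτ hψ hΦ
  intro t k hk N hN p hp hpD hguard
  obtain ⟨q, rfl⟩ : ∃ q, p = q + 1 := ⟨p - 1, by omega⟩
  have hN1 : 1 ≤ N := by omega
  have hKb : 0 < Kb := by omega
  rcases Nat.eq_zero_or_pos k with rfl | hk1
  · -- block 0
    simp only [if_true] at hguard ⊢
    have hκ0 : κ 0 ^ 2 ≤ κb ^ 2 := by simpa using hκκb 0 hk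
    have hα0 : α 0 ≤ αb := by simpa using hααb 0 hk
    exact klTowerBLev_one_le_kitStep_of_bounds hβ U μ K d hZ0 (hκ 0 hk) hκb hκ0 (hGB0 hKb) hαb hα0 (hrow0 hKb) (hcol0 hKb) hcrb hccb
      (hrow0' hKb) (hcol0' hKb) (hD0 hKb) hN1 hguard t q
  · -- blocks k ≥ 1
    have hk0 : k ≠ 0 := by omega
    simp only [hk0, if_false] at hguard ⊢
    exact klTowerBLev_succ_le_kitStep_of_bounds hβ U μ K hd hk1 (hZ k hk1 hk) (hκ k hk) hκb (hκκb k hk) (hGB k hk1 hk) hαb (hααb k hk)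
      (hrow k hk1 hk) (hcol k hk1 hk) hcrb hccb (hrow' k hk1 hk) (hcol' k hk1 hk) (hD k hk1 hk) hN1 hguard t q

end Summit.HubbardSuperconductivity.HubbardSuperconductivity.Theorems.EngineV8

end
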